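import Literature.NumberTheory.LFunctions.SelbergClassUniformConvexity
import HarnessLib

/-!
# A Selberg datum matching a Dirichlet series off finitely many Euler factors continues it, with a
# polynomial bound on the disc `|s − 2| ≤ 3/2`

Topic `NumberTheory/LFunctions`; namespace `Literature.NumberTheory.LFunctions`. Theorems only (no
definition, no named fact; D-0026).

The situation of every "partial `L`-function" consumer (Goldfeld–Hoffstein–Lieman, Hoffstein–Lockhart,
…): an explicit Euler product `P(s)` (say the good-prime part of `L(s, π)` times explicit harmless
factors at the bad primes, all with parameters of modulus `≤ 1`) is known on `Re s > 1`, and the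
automorphic theory supplies the COMPLETE `L`-function `F = L(s, π)` as a member of the Selberg class
(`SelbergDatum`, `SelbergClass.lean`) whose Euler factors agree with those of `P` at the primes off a
finite set `S` and are, at `p ∈ S`, at most `m` inverse linear factors `(1 − β p^{−s})⁻¹`, `|β| ≤ 1`
(the ramified factors of a tempered representation, Iwaniec–Kowalski §5.1 (5.3)). Then `P` continues
to `{Re s > 0}` as `G = F · ∏_{p∈S}∏_k(1 − β p^{−s}) / ∏_{p∈S}∏_l(1 − v p^{−s})`, and the uniform
convexity bound for the shape class of `F` (`SelbergDatum.exists_uniform_norm_pow_mul_toFun_le`,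
`SelbergClassUniformConvexity.lean`) gives `‖G‖ ≤ C max(1,Q)^K (∏_{p∈S} p)^{m+2m'}` on
`|s − 2| ≤ 3/2`, with `C, K` depending only on the shape class, on `m, m'` and on a bound `P₀` for
`P` on `Re s ≥ 3/2`:

* bad-factor bookkeeping (`norm_mul_primeCpow_neg_le`, `prod_one_sub_ne_zero`,
  `differentiable_prod_one_sub`, `norm_prod_one_sub_le_pow` (`≤ (∏p)^m` on `Re s ≥ 1/2`),
  `norm_inv_prod_one_sub_le_pow` (`≤ (∏p)^{2m}` on `Re s ≥ 1/2`), `norm_prod_one_sub_le_exp`,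
  `norm_inv_prod_one_sub_le_exp` (uniform bounds `e^{m∑n^{−3/2}}`, `e^{2m∑n^{−3/2}}` on `Re s ≥ 3/2`));
* `SelbergDatum.exists_continuation_of_eulerMatch` — **main**.

The same computation is carried out inline, for `L(s, Sym⁴ f)`, in
`Automorphic/KimSymmetricFourthGL2Reduction`; it is isolated here for the pair functions
`L(s, Sym² f_i × Sym² f_j)` of `EllipticCurves/NewformPeterssonSizePairSelbergReductionProofs` and any
later partial-`L`-function consumer.

## References

* H. Iwaniec, E. Kowalski, *Analytic Number Theory*, AMS Colloq. Publ. 53 (2004), §5.1 (5.1)–(5.3)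
  (local factors), §5.2 (5.20)–(5.21) (convexity bound). [IwaniecKowalski2004]

## Mathlib / tree search

Tree: `SelbergDatum` (`SelbergClass`), `SelbergDatum.exists_uniform_norm_pow_mul_toFun_le`
(`SelbergClassUniformConvexity`); the bad-factor lemmas of `Automorphic/KimSymmetricFourthGL2Reduction`
(`norm_prod_badFactor_le` etc., for `Fin 5` and `N.primeFactors`; the computation is redone here for
`Fin m` and any finite set of primes, that module not being importable from `LFunctions/`). Mathlib: `Differentiable.fun_finsetProd`,
`Differentiable.const_cpow`, `Complex.norm_natCast_cpow_of_pos`, `Real.summable_nat_rpow`,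
`Summable.sum_le_tsum`, `le_of_tendsto`, `eq_mul_inv_iff_mul_eq₀`.
-/

noncomputable section

open Complex Metric Set Filter Topology

namespace Literature.NumberTheory.LFunctions

/-! ### Bad Euler factors `∏_{p ∈ S} ∏_{k<m} (1 − β_{p,k} p^{−s})`, `|β| ≤ 1` -/

namespace EulerMatch

/-- `‖β p^{-s}‖ ≤ p^{-σ₀}` for `|β| ≤ 1`, `p` prime, `σ₀ ≤ Re s`. [folklore] -/
theorem norm_mul_primeCpow_neg_le {β : ℂ} (hβ : ‖β‖ ≤ 1) {p : ℕ} (hp : p.Prime) {s : ℂ} {σ₀ : ℝ}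
    (hs : σ₀ ≤ s.re) : ‖β * (p : ℂ) ^ (-s)‖ ≤ (p : ℝ) ^ (-σ₀) := by
  rw [norm_mul, Complex.norm_natCast_cpow_of_pos hp.pos, Complex.neg_re]
  have hp1 : (1 : ℝ) ≤ p := by exact_mod_cast hp.one_lt.le
  have h0 : 0 ≤ (p : ℝ) ^ (-s.re) := Real.rpow_nonneg (by positivity) _
  calc ‖β‖ * (p : ℝ) ^ (-s.re) ≤ 1 * (p : ℝ) ^ (-s.re) := mul_le_mul_of_nonneg_right hβ h0
    _ ≤ (p : ℝ) ^ (-σ₀) := by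
        rw [one_mul]; exact Real.rpow_le_rpow_of_exponent_le hp1 (by linarith)

/-- The product `∏_{p ∈ S} ∏_k (1 − β_{p,k} p^{−s})` over a set of primes does not vanish on
`Re s > 0` (each `|β p^{−s}| < 1`). [folklore] -/
theorem prod_one_sub_ne_zero {S : Finset ℕ} (hS : ∀ p ∈ S, p.Prime) {m : ℕ} {β : ℕ → Fin m → ℂ}
    (hβ : ∀ p ∈ S, ∀ k, ‖β p k‖ ≤ 1) {s : ℂ} (hs : 0 < s.re) :
    ∏ p ∈ S, ∏ k : Fin m, (1 - β p k * (p : ℂ) ^ (-s)) ≠ 0 := by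
  refine Finset.prod_ne_zero_iff.mpr fun p hp ↦ Finset.prod_ne_zero_iff.mpr fun k _ ↦ ?_
  intro h
  have h1 : β p k * (p : ℂ) ^ (-s) = 1 := (sub_eq_zero.mp h).symm
  have h2 : ‖β p k * (p : ℂ) ^ (-s)‖ < 1 := by
    rw [norm_mul, Complex.norm_natCast_cpow_of_pos (hS p hp).pos, Complex.neg_re]
    have hp2 : (1 : ℝ) < p := by exact_mod_cast (hS p hp).one_lt
    have hlt : (p : ℝ) ^ (-s.re) < 1 := Real.rpow_lt_one_of_one_lt_of_neg hp2 (by linarith)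
    have h0 : 0 ≤ (p : ℝ) ^ (-s.re) := Real.rpow_nonneg (by positivity) _
    calc ‖β p k‖ * (p : ℝ) ^ (-s.re) ≤ 1 * (p : ℝ) ^ (-s.re) :=
          mul_le_mul_of_nonneg_right (hβ p hp k) h0
      _ < 1 := by rw [one_mul]; exact hlt
  rw [h1, norm_one] at h2
  exact lt_irrefl _ h2

/-- The product is an entire function of `s`. [folklore] -/
theorem differentiable_prod_one_sub {S : Finset ℕ} (hS : ∀ p ∈ S, p.Prime) {m : ℕ}
    (β : ℕ → Fin m → ℂ) :
    Differentiable ℂ fun s : ℂ ↦ ∏ p ∈ S, ∏ k : Fin m, (1 - β p k * (p : ℂ) ^ (-s)) := by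
  have hcpow : ∀ p ∈ S, Differentiable ℂ fun s : ℂ ↦ (p : ℂ) ^ (-s) := fun p hp ↦
    differentiable_id.neg.const_cpow (Or.inl (Nat.cast_ne_zero.mpr (hS p hp).ne_zero))
  refine Differentiable.fun_finsetProd fun p hp ↦ ?_
  refine Differentiable.fun_finsetProd fun j _ ↦ ?_
  exact (differentiable_const _).sub ((differentiable_const _).mul (hcpow p hp))

/-- **On `Re s ≥ 1/2`: `‖∏_{p ∈ S} ∏_{k<m} (1 − β p^{−s})‖ ≤ (∏_{p∈S} p)^m`** (each factor has modulus
`≤ 2 ≤ p`). [folklore] -/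
theorem norm_prod_one_sub_le_pow {S : Finset ℕ} (hS : ∀ p ∈ S, p.Prime) {m : ℕ} {β : ℕ → Fin m → ℂ}
    (hβ : ∀ p ∈ S, ∀ k, ‖β p k‖ ≤ 1) {s : ℂ} (hs : 1 / 2 ≤ s.re) :
    ‖∏ p ∈ S, ∏ k : Fin m, (1 - β p k * (p : ℂ) ^ (-s))‖ ≤ (((∏ p ∈ S, p : ℕ) : ℝ)) ^ m := by
  have hfac : ∀ p ∈ S, ∀ k : Fin m, ‖1 - β p k * (p : ℂ) ^ (-s)‖ ≤ 2 := by
    intro p hp k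
    have hpr := hS p hp
    have hp1 : (1 : ℝ) ≤ p := by exact_mod_cast hpr.one_lt.le
    have hz : ‖β p k * (p : ℂ) ^ (-s)‖ ≤ (p : ℝ) ^ (-(1 / 2 : ℝ)) :=
      norm_mul_primeCpow_neg_le (hβ p hp k) hpr hs
    have hz1 : (p : ℝ) ^ (-(1 / 2 : ℝ)) ≤ 1 := Real.rpow_le_one_of_one_le_of_nonpos hp1 (by norm_num)
    calc ‖1 - β p k * (p : ℂ) ^ (-s)‖ ≤ ‖(1 : ℂ)‖ + ‖β p k * (p : ℂ) ^ (-s)‖ := norm_sub_le _ _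
      _ ≤ 1 + 1 := by rw [norm_one]; linarith [hz.trans hz1]
      _ = 2 := by norm_num
  calc ‖∏ p ∈ S, ∏ k : Fin m, (1 - β p k * (p : ℂ) ^ (-s))‖
      = ∏ p ∈ S, ∏ k : Fin m, ‖1 - β p k * (p : ℂ) ^ (-s)‖ := by
        rw [norm_prod]; exact Finset.prod_congr rfl fun p _ ↦ norm_prod _ _
    _ ≤ ∏ p ∈ S, ((p : ℝ)) ^ m := by
        refine Finset.prod_le_prod (fun p _ ↦ Finset.prod_nonneg fun j _ ↦ norm_nonneg _)
          (fun p hp ↦ ?_)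
        have hp2 : (2 : ℝ) ≤ p := by exact_mod_cast (hS p hp).two_le
        calc ∏ k : Fin m, ‖1 - β p k * (p : ℂ) ^ (-s)‖ ≤ ∏ _k : Fin m, (2 : ℝ) :=
              Finset.prod_le_prod (fun j _ ↦ norm_nonneg _) (fun j _ ↦ hfac p hp j)
          _ = 2 ^ m := by rw [Finset.prod_const, Finset.card_univ, Fintype.card_fin]
          _ ≤ (p : ℝ) ^ m := pow_le_pow_left₀ (by norm_num) hp2 m
    _ = ((∏ p ∈ S, p : ℕ) : ℝ) ^ m := by
        rw [Finset.prod_pow]; push_cast; rfl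

/-- **On `Re s ≥ 1/2`: `‖(∏_{p ∈ S} ∏_{k<m} (1 − β p^{−s}))⁻¹‖ ≤ (∏_{p∈S} p)^{2m}`** (each inverted
factor has modulus `≤ (1 − 2^{−1/2})⁻¹ ≤ 4 ≤ p²`). [folklore] -/
theorem norm_inv_prod_one_sub_le_pow {S : Finset ℕ} (hS : ∀ p ∈ S, p.Prime) {m : ℕ}
    {β : ℕ → Fin m → ℂ} (hβ : ∀ p ∈ S, ∀ k, ‖β p k‖ ≤ 1) {s : ℂ} (hs : 1 / 2 ≤ s.re) :
    ‖(∏ p ∈ S, ∏ k : Fin m, (1 - β p k * (p : ℂ) ^ (-s)))⁻¹‖ ≤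
      (((∏ p ∈ S, p : ℕ) : ℝ)) ^ (2 * m) := by
  have hfac : ∀ p ∈ S, ∀ k : Fin m, ‖(1 - β p k * (p : ℂ) ^ (-s))⁻¹‖ ≤ 4 := by
    intro p hp k
    have hpr := hS p hp
    have hp2 : (2 : ℝ) ≤ p := by exact_mod_cast hpr.two_le
    have hz : ‖β p k * (p : ℂ) ^ (-s)‖ ≤ (p : ℝ) ^ (-(1 / 2 : ℝ)) :=
      norm_mul_primeCpow_neg_le (hβ p hp k) hpr hs
    have hz2 : (p : ℝ) ^ (-(1 / 2 : ℝ)) ≤ (2 : ℝ) ^ (-(1 / 2 : ℝ)) :=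
      Real.rpow_le_rpow_of_nonpos (by norm_num) hp2 (by norm_num)
    have htwo : (2 : ℝ) ^ (-(1 / 2 : ℝ)) ≤ 3 / 4 := by
      have h0 : (0 : ℝ) ≤ (2 : ℝ) ^ (-(1 / 2 : ℝ)) := Real.rpow_nonneg (by norm_num) _
      have hsq : ((2 : ℝ) ^ (-(1 / 2 : ℝ))) ^ 2 = 1 / 2 := by
        rw [← Real.rpow_natCast, ← Real.rpow_mul (by norm_num)]
        norm_num
      nlinarith [hsq, h0]
    have hz3 : ‖β p k * (p : ℂ) ^ (-s)‖ ≤ 3 / 4 := (hz.trans hz2).trans htwo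
    have h1 : 1 - ‖β p k * (p : ℂ) ^ (-s)‖ ≤ ‖1 - β p k * (p : ℂ) ^ (-s)‖ := by
      have := norm_sub_norm_le (1 : ℂ) (β p k * (p : ℂ) ^ (-s))
      rwa [norm_one] at this
    have hpos : (1 / 4 : ℝ) ≤ ‖1 - β p k * (p : ℂ) ^ (-s)‖ := by linarith
    rw [norm_inv]
    calc ‖1 - β p k * (p : ℂ) ^ (-s)‖⁻¹ ≤ (1 / 4 : ℝ)⁻¹ := inv_anti₀ (by norm_num) hpos
      _ = 4 := by norm_num
  have hrw : (∏ p ∈ S, ∏ k : Fin m, (1 - β p k * (p : ℂ) ^ (-s)))⁻¹ =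
      ∏ p ∈ S, ∏ k : Fin m, (1 - β p k * (p : ℂ) ^ (-s))⁻¹ := by
    rw [← Finset.prod_inv_distrib]
    exact Finset.prod_congr rfl fun p _ ↦ (Finset.prod_inv_distrib _).symm
  rw [hrw]
  calc ‖∏ p ∈ S, ∏ k : Fin m, (1 - β p k * (p : ℂ) ^ (-s))⁻¹‖
      = ∏ p ∈ S, ∏ k : Fin m, ‖(1 - β p k * (p : ℂ) ^ (-s))⁻¹‖ := by
        rw [norm_prod]; exact Finset.prod_congr rfl fun p _ ↦ norm_prod _ _
    _ ≤ ∏ p ∈ S, ((p : ℝ)) ^ (2 * m) := by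
        refine Finset.prod_le_prod (fun p _ ↦ Finset.prod_nonneg fun j _ ↦ norm_nonneg _)
          (fun p hp ↦ ?_)
        have hp2 : (2 : ℝ) ≤ p := by exact_mod_cast (hS p hp).two_le
        calc ∏ k : Fin m, ‖(1 - β p k * (p : ℂ) ^ (-s))⁻¹‖ ≤ ∏ _k : Fin m, (4 : ℝ) :=
              Finset.prod_le_prod (fun j _ ↦ norm_nonneg _) (fun j _ ↦ hfac p hp j)
          _ = 4 ^ m := by rw [Finset.prod_const, Finset.card_univ, Fintype.card_fin]
          _ = (2 ^ 2) ^ m := by norm_num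
          _ ≤ ((p : ℝ) ^ 2) ^ m :=
              pow_le_pow_left₀ (by norm_num) (pow_le_pow_left₀ (by norm_num) hp2 2) m
          _ = (p : ℝ) ^ (2 * m) := by rw [← pow_mul]
    _ = ((∏ p ∈ S, p : ℕ) : ℝ) ^ (2 * m) := by
        rw [Finset.prod_pow]; push_cast; rfl

/-- `‖1 − z‖ ≤ exp ‖z‖`. [folklore] -/
theorem norm_one_sub_le_exp (z : ℂ) : ‖1 - z‖ ≤ Real.exp ‖z‖ :=
  calc ‖1 - z‖ ≤ ‖(1 : ℂ)‖ + ‖z‖ := norm_sub_le _ _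
    _ = ‖z‖ + 1 := by rw [norm_one, add_comm]
    _ ≤ Real.exp ‖z‖ := Real.add_one_le_exp _

/-- **On `Re s ≥ 3/2` the bad products are bounded independently of `S`**:
`‖∏_{p∈S}∏_{k<m}(1 − β p^{−s})‖ ≤ exp (m ∑_n n^{−3/2})`. [folklore] -/
theorem norm_prod_one_sub_le_exp {S : Finset ℕ} (hS : ∀ p ∈ S, p.Prime) {m : ℕ} {β : ℕ → Fin m → ℂ}
    (hβ : ∀ p ∈ S, ∀ k, ‖β p k‖ ≤ 1) {s : ℂ} (hs : 3 / 2 ≤ s.re) :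
    ‖∏ p ∈ S, ∏ k : Fin m, (1 - β p k * (p : ℂ) ^ (-s))‖ ≤
      Real.exp (m * ∑' n : ℕ, (n : ℝ) ^ (-(3 / 2 : ℝ))) := by
  have hsum : Summable fun n : ℕ ↦ (n : ℝ) ^ (-(3 / 2 : ℝ)) :=
    Real.summable_nat_rpow.mpr (by norm_num)
  have hfac : ∀ p ∈ S, ∀ k : Fin m,
      ‖1 - β p k * (p : ℂ) ^ (-s)‖ ≤ Real.exp ((p : ℝ) ^ (-(3 / 2 : ℝ))) := by
    intro p hp k
    have hz : ‖β p k * (p : ℂ) ^ (-s)‖ ≤ (p : ℝ) ^ (-(3 / 2 : ℝ)) :=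
      norm_mul_primeCpow_neg_le (hβ p hp k) (hS p hp) hs
    exact (norm_one_sub_le_exp _).trans (Real.exp_le_exp.mpr hz)
  calc ‖∏ p ∈ S, ∏ k : Fin m, (1 - β p k * (p : ℂ) ^ (-s))‖
      = ∏ p ∈ S, ∏ k : Fin m, ‖1 - β p k * (p : ℂ) ^ (-s)‖ := by
        rw [norm_prod]; exact Finset.prod_congr rfl fun p _ ↦ norm_prod _ _
    _ ≤ ∏ p ∈ S, ∏ _k : Fin m, Real.exp ((p : ℝ) ^ (-(3 / 2 : ℝ))) :=
        Finset.prod_le_prod (fun p _ ↦ Finset.prod_nonneg fun j _ ↦ norm_nonneg _)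
          (fun p hp ↦ Finset.prod_le_prod (fun j _ ↦ norm_nonneg _) (fun j _ ↦ hfac p hp j))
    _ = Real.exp (∑ p ∈ S, m * (p : ℝ) ^ (-(3 / 2 : ℝ))) := by
        rw [Real.exp_sum]
        refine Finset.prod_congr rfl fun p _ ↦ ?_
        rw [Finset.prod_const, Finset.card_univ, Fintype.card_fin, ← Real.exp_nat_mul]
    _ ≤ Real.exp (m * ∑' n : ℕ, (n : ℝ) ^ (-(3 / 2 : ℝ))) := by
        apply Real.exp_le_exp.mpr
        rw [← Finset.mul_sum]
        refine mul_le_mul_of_nonneg_left ?_ (Nat.cast_nonneg m)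
        exact Summable.sum_le_tsum _ (fun n _ ↦ Real.rpow_nonneg (Nat.cast_nonneg n) _) hsum

/-- **On `Re s ≥ 3/2` the inverted bad products are bounded independently of `S`**:
`‖(∏_{p∈S}∏_{k<m}(1 − β p^{−s}))⁻¹‖ ≤ exp (2m ∑_n n^{−3/2})`. [folklore] -/
theorem norm_inv_prod_one_sub_le_exp {S : Finset ℕ} (hS : ∀ p ∈ S, p.Prime) {m : ℕ}
    {β : ℕ → Fin m → ℂ} (hβ : ∀ p ∈ S, ∀ k, ‖β p k‖ ≤ 1) {s : ℂ} (hs : 3 / 2 ≤ s.re) :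
    ‖(∏ p ∈ S, ∏ k : Fin m, (1 - β p k * (p : ℂ) ^ (-s)))⁻¹‖ ≤
      Real.exp (2 * m * ∑' n : ℕ, (n : ℝ) ^ (-(3 / 2 : ℝ))) := by
  have hsum : Summable fun n : ℕ ↦ (n : ℝ) ^ (-(3 / 2 : ℝ)) :=
    Real.summable_nat_rpow.mpr (by norm_num)
  have hhalf : ∀ p ∈ S, (p : ℝ) ^ (-(3 / 2 : ℝ)) ≤ 1 / 2 := by
    intro p hp
    have hp2 : (2 : ℝ) ≤ p := by exact_mod_cast (hS p hp).two_le
    calc (p : ℝ) ^ (-(3 / 2 : ℝ)) ≤ (2 : ℝ) ^ (-(3 / 2 : ℝ)) :=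
          Real.rpow_le_rpow_of_nonpos (by norm_num) hp2 (by norm_num)
      _ ≤ (2 : ℝ) ^ (-1 : ℝ) := Real.rpow_le_rpow_of_exponent_le (by norm_num) (by norm_num)
      _ = 1 / 2 := by rw [Real.rpow_neg_one]; norm_num
  -- `‖(1 − z)⁻¹‖ ≤ exp (2‖z‖)` for `‖z‖ ≤ 1/2`
  have hinv : ∀ z : ℂ, ‖z‖ ≤ 1 / 2 → ‖(1 - z)⁻¹‖ ≤ Real.exp (2 * ‖z‖) := by
    intro z hz
    have h1 : 1 - ‖z‖ ≤ ‖1 - z‖ := by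
      have := norm_sub_norm_le (1 : ℂ) z
      rwa [norm_one] at this
    have hpos : 0 < 1 - ‖z‖ := by linarith
    have hz0 := norm_nonneg z
    rw [norm_inv]
    calc ‖1 - z‖⁻¹ ≤ (1 - ‖z‖)⁻¹ := inv_anti₀ hpos h1
      _ ≤ 1 + 2 * ‖z‖ := by
          rw [inv_eq_one_div, div_le_iff₀ hpos]
          nlinarith
      _ ≤ Real.exp (2 * ‖z‖) := by linarith [Real.add_one_le_exp (2 * ‖z‖)]
  have hfac : ∀ p ∈ S, ∀ k : Fin m,
      ‖(1 - β p k * (p : ℂ) ^ (-s))⁻¹‖ ≤ Real.exp (2 * (p : ℝ) ^ (-(3 / 2 : ℝ))) := by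
    intro p hp k
    have hz : ‖β p k * (p : ℂ) ^ (-s)‖ ≤ (p : ℝ) ^ (-(3 / 2 : ℝ)) :=
      norm_mul_primeCpow_neg_le (hβ p hp k) (hS p hp) hs
    exact (hinv _ (hz.trans (hhalf p hp))).trans (Real.exp_le_exp.mpr (by linarith))
  have hrw : (∏ p ∈ S, ∏ k : Fin m, (1 - β p k * (p : ℂ) ^ (-s)))⁻¹ =
      ∏ p ∈ S, ∏ k : Fin m, (1 - β p k * (p : ℂ) ^ (-s))⁻¹ := by
    rw [← Finset.prod_inv_distrib]
    exact Finset.prod_congr rfl fun p _ ↦ (Finset.prod_inv_distrib _).symm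
  rw [hrw]
  calc ‖∏ p ∈ S, ∏ k : Fin m, (1 - β p k * (p : ℂ) ^ (-s))⁻¹‖
      = ∏ p ∈ S, ∏ k : Fin m, ‖(1 - β p k * (p : ℂ) ^ (-s))⁻¹‖ := by
        rw [norm_prod]; exact Finset.prod_congr rfl fun p _ ↦ norm_prod _ _
    _ ≤ ∏ p ∈ S, ∏ _k : Fin m, Real.exp (2 * (p : ℝ) ^ (-(3 / 2 : ℝ))) :=
        Finset.prod_le_prod (fun p _ ↦ Finset.prod_nonneg fun j _ ↦ norm_nonneg _)
          (fun p hp ↦ Finset.prod_le_prod (fun j _ ↦ norm_nonneg _) (fun j _ ↦ hfac p hp j))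
    _ = Real.exp (∑ p ∈ S, 2 * m * (p : ℝ) ^ (-(3 / 2 : ℝ))) := by
        rw [Real.exp_sum]
        refine Finset.prod_congr rfl fun p _ ↦ ?_
        rw [Finset.prod_const, Finset.card_univ, Fintype.card_fin, ← Real.exp_nat_mul]
        congr 1; ring
    _ ≤ Real.exp (2 * m * ∑' n : ℕ, (n : ℝ) ^ (-(3 / 2 : ℝ))) := by
        apply Real.exp_le_exp.mpr
        rw [← Finset.mul_sum]
        refine mul_le_mul_of_nonneg_left ?_ (by positivity)
        exact Summable.sum_le_tsum _ (fun n _ ↦ Real.rpow_nonneg (Nat.cast_nonneg n) _) hsum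

end EulerMatch

/-! ### The continuation theorem -/

namespace SelbergDatum

open EulerMatch

set_option maxHeartbeats 800000 in
/-- **A Selberg datum matching `P` off finitely many tempered Euler factors continues `P` with a
polynomial bound on `|s − 2| ≤ 3/2`.** Fix a shape class (`numGamma ≤ n`, `λ₀ ≤ λ_k ≤ Λ₀`,
`‖μ_k‖ ≤ M₀`), the numbers `m, m'` of bad factors and a bound `P₀`. There are `C > 0`, `K ≥ 0` such
that: for every finite set `S` of primes, every `P : ℂ → ℂ` with `‖P s‖ ≤ P₀` on `Re s ≥ 3/2`, all
letters `v_{p,l}` (`p ∈ S`, `l < m'`, `|v| ≤ 1`), every pole-free Selberg datum `D` of the class and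
all `β_{p,k}` (`p ∈ S`, `k < m`, `|β| ≤ 1`) with
`P(s) ∏_{p∈S}∏_l (1 − v_{p,l} p^{−s}) = F(s) ∏_{p∈S}∏_k (1 − β_{p,k} p^{−s})` on `Re s > 1`
(`F = D.toFun`: "`F` and `P` have the same Euler factors off `S`"), the function
`G = F ∏(1 − β p^{−s}) / ∏(1 − v p^{−s})` is holomorphic on `|s − 2| < 3/2`, equals `P` on
`Re s > 1`, and `‖G s‖ ≤ C max(1, Q)^K (∏_{p∈S} p)^{m + 2m'}` on `|s − 2| ≤ 3/2`. Proof: on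
`Re s ≥ 3/2`, `‖F‖ ≤ P₀ e^{(m' + 2m)∑n^{−3/2}} =: A₀` (`norm_prod_one_sub_le_exp`,
`norm_inv_prod_one_sub_le_exp`), so the uniform convexity bound
`SelbergDatum.exists_uniform_norm_pow_mul_toFun_le` bounds `F` by `C max(1,Q)^A (5/2)^A` on the box
`1/2 ≤ Re s ≤ 7/2`, `|Im s| ≤ 3/2` off `s = 1`, and at `s = 1` by continuity of the entire
representative; the bad factors contribute `(∏p)^m (∏p)^{2m'}` (`norm_prod_one_sub_le_pow`,
`norm_inv_prod_one_sub_le_pow`). [cite: IwaniecKowalski2004, §5.2 (5.20)–(5.21)] -/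
theorem exists_continuation_of_eulerMatch (n m m' : ℕ) {lam₀ : ℝ} (hlam₀ : 0 < lam₀)
    (Λ₀ M₀ P₀ : ℝ) :
    ∃ C K : ℝ, 0 < C ∧ 0 ≤ K ∧
      ∀ (S : Finset ℕ), (∀ p ∈ S, p.Prime) →
      ∀ (P : ℂ → ℂ), (∀ s : ℂ, 3 / 2 ≤ s.re → ‖P s‖ ≤ P₀) →
      ∀ (v : ℕ → Fin m' → ℂ), (∀ p ∈ S, ∀ l, ‖v p l‖ ≤ 1) →
      ∀ (D : SelbergDatum), D.polarOrder = 0 → D.numGamma ≤ n →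
        (∀ k, lam₀ ≤ D.lam k) → (∀ k, D.lam k ≤ Λ₀) → (∀ k, ‖D.mu k‖ ≤ M₀) →
      ∀ (β : ℕ → Fin m → ℂ), (∀ p ∈ S, ∀ k, ‖β p k‖ ≤ 1) →
        (∀ s : ℂ, 1 < s.re →
          P s * ∏ p ∈ S, ∏ l : Fin m', (1 - v p l * (p : ℂ) ^ (-s)) =
            D.toFun s * ∏ p ∈ S, ∏ k : Fin m, (1 - β p k * (p : ℂ) ^ (-s))) →
        ∃ G : ℂ → ℂ, DifferentiableOn ℂ G (ball (2 : ℂ) (3 / 2)) ∧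
          (∀ s : ℂ, 1 < s.re → G s = P s) ∧
          ∀ s ∈ closedBall (2 : ℂ) (3 / 2),
            ‖G s‖ ≤ C * max 1 D.Q ^ K * (((∏ p ∈ S, p : ℕ) : ℝ)) ^ (m + 2 * m') := by
  -- the universal bound on `Re s ≥ 3/2`
  set T : ℝ := ∑' n : ℕ, (n : ℝ) ^ (-(3 / 2 : ℝ)) with hT
  set A₀ : ℝ := max P₀ 0 * Real.exp (m' * T) * Real.exp (2 * m * T) with hA₀
  obtain ⟨C, A, hC, hA, hconv⟩ :=
    SelbergDatum.exists_uniform_norm_pow_mul_toFun_le n 0 hlam₀ Λ₀ M₀ A₀ (1 / 2) (7 / 2)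
  refine ⟨C * (5 / 2 : ℝ) ^ A, A, by positivity, hA, ?_⟩
  intro S hS P hP v hv D hm0 hn hlam hΛ hμ β hβ hEq
  -- notation for the bad products
  set Bv : ℂ → ℂ := fun s ↦ ∏ p ∈ S, ∏ l : Fin m', (1 - v p l * (p : ℂ) ^ (-s)) with hBv
  set Bβ : ℂ → ℂ := fun s ↦ ∏ p ∈ S, ∏ k : Fin m, (1 - β p k * (p : ℂ) ^ (-s)) with hBβ
  have hBv0 : ∀ s : ℂ, 0 < s.re → Bv s ≠ 0 := fun s hs ↦ prod_one_sub_ne_zero hS hv hs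
  have hBβ0 : ∀ s : ℂ, 0 < s.re → Bβ s ≠ 0 := fun s hs ↦ prod_one_sub_ne_zero hS hβ hs
  have hEq' : ∀ s : ℂ, 1 < s.re → P s * Bv s = D.toFun s * Bβ s := fun s hs ↦ hEq s hs
  -- the entire representative
  obtain ⟨G₀, hG₀, hG₀F⟩ := D.differentiable
  have hG₀F' : ∀ s, s ≠ 1 → G₀ s = D.toFun s := fun s hs ↦ by
    rw [hG₀F s hs, hm0, pow_zero, one_mul]
  -- `‖F‖ ≤ A₀` on `Re s ≥ 3/2`
  have hA₀D : ∀ s : ℂ, 3 / 2 ≤ s.re → ‖D.toFun s‖ ≤ A₀ := by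
    intro s hs
    have hs0 : 0 < s.re := by linarith
    have hF : D.toFun s = P s * Bv s * (Bβ s)⁻¹ := by
      rw [eq_mul_inv_iff_mul_eq₀ (hBβ0 s hs0)]
      exact (hEq' s (by linarith)).symm
    rw [hF, norm_mul, norm_mul, hA₀]
    have h1 : ‖P s‖ ≤ max P₀ 0 := (hP s hs).trans (le_max_left _ _)
    have h2 : ‖Bv s‖ ≤ Real.exp (m' * T) := norm_prod_one_sub_le_exp hS hv hs
    have h3 : ‖(Bβ s)⁻¹‖ ≤ Real.exp (2 * m * T) := norm_inv_prod_one_sub_le_exp hS hβ hs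
    have h12 : ‖P s‖ * ‖Bv s‖ ≤ max P₀ 0 * Real.exp (m' * T) :=
      mul_le_mul h1 h2 (norm_nonneg _) (le_max_right _ _)
    exact mul_le_mul h12 h3 (norm_nonneg _) (by positivity)
  -- the uniform convexity bound for this datum
  have hconvD := hconv D hn (by rw [hm0]) hlam hΛ hμ hA₀D
  set Bnd : ℝ := C * (5 / 2 : ℝ) ^ A * max 1 D.Q ^ A with hBnd
  have hQ1 : (1 : ℝ) ≤ max 1 D.Q := le_max_left _ _
  have hBnd0 : 0 ≤ Bnd := by rw [hBnd]; positivity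
  have key : ∀ s : ℂ, 1 / 2 ≤ s.re → s.re ≤ 7 / 2 → |s.im| ≤ 3 / 2 → s ≠ 1 → ‖G₀ s‖ ≤ Bnd := by
    intro s h1 h2 h3 h4
    have hc := hconvD s h1 h2 h4
    rw [hm0, pow_zero, one_mul] at hc
    rw [hG₀F' s h4]
    refine hc.trans ?_
    have ht0 : 0 ≤ 1 + |s.im| := by linarith [abs_nonneg s.im]
    have h5 : (1 + |s.im|) ^ A ≤ (5 / 2 : ℝ) ^ A := Real.rpow_le_rpow ht0 (by linarith) hA
    calc C * max 1 D.Q ^ A * (1 + |s.im|) ^ A ≤ C * max 1 D.Q ^ A * (5 / 2 : ℝ) ^ A :=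
          mul_le_mul_of_nonneg_left h5 (by positivity)
      _ = Bnd := by rw [hBnd]; ring
  have hG₀bound : ∀ s : ℂ, 1 / 2 ≤ s.re → s.re ≤ 7 / 2 → |s.im| ≤ 3 / 2 → ‖G₀ s‖ ≤ Bnd := by
    intro s h1 h2 h3
    by_cases h4 : s = 1
    · -- continuity at `s = 1`
      subst h4
      have htend : Tendsto (fun z ↦ ‖G₀ z‖) (𝓝[≠] (1 : ℂ)) (𝓝 ‖G₀ 1‖) :=
        ((hG₀.continuous.continuousAt (x := (1 : ℂ))).norm.tendsto).mono_left nhdsWithin_le_nhds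
      refine le_of_tendsto htend ?_
      have hball : ∀ᶠ z in 𝓝[≠] (1 : ℂ), z ∈ ball (1 : ℂ) (1 / 2) ∧ z ≠ 1 := by
        refine eventually_nhdsWithin_iff.mpr ?_
        have : ∀ᶠ z in 𝓝 (1 : ℂ), z ∈ ball (1 : ℂ) (1 / 2) := ball_mem_nhds _ (by norm_num)
        exact this.mono fun z hz hne ↦ ⟨hz, hne⟩
      refine hball.mono fun z hz ↦ ?_
      obtain ⟨hz, hne⟩ := hz
      rw [mem_ball, dist_eq_norm] at hz
      have hre := abs_re_le_norm (z - 1)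
      have him := abs_im_le_norm (z - 1)
      rw [sub_re, Complex.one_re] at hre
      rw [sub_im, Complex.one_im, sub_zero] at him
      have hre' := abs_le.mp (hre.trans hz.le)
      exact key z (by linarith [hre'.1]) (by linarith [hre'.2]) (by linarith) hne
    · exact key s h1 h2 h3 h4
  -- the continuation `G = G₀ · Bβ / Bv`
  have hdBβ : Differentiable ℂ Bβ := differentiable_prod_one_sub hS β
  have hdBv : Differentiable ℂ Bv := differentiable_prod_one_sub hS v
  have hball_re : ∀ s ∈ ball (2 : ℂ) (3 / 2), 0 < s.re := by
    intro s hs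
    rw [mem_ball, dist_eq_norm] at hs
    have hre := abs_re_le_norm (s - 2)
    rw [sub_re, show (2 : ℂ).re = 2 from rfl] at hre
    have hre' := abs_le.mp (hre.trans hs.le)
    linarith [hre'.1]
  refine ⟨fun s ↦ G₀ s * Bβ s * (Bv s)⁻¹, ?_, ?_, ?_⟩
  · exact ((hG₀.mul hdBβ).differentiableOn).mul
      (hdBv.differentiableOn.inv fun s hs ↦ hBv0 s (hball_re s hs))
  · intro s hs
    have hs1 : s ≠ 1 := fun h ↦ by rw [h, Complex.one_re] at hs; exact lt_irrefl _ hs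
    show G₀ s * Bβ s * (Bv s)⁻¹ = P s
    rw [hG₀F' s hs1, eq_comm, eq_mul_inv_iff_mul_eq₀ (hBv0 s (by linarith))]
    exact hEq' s hs
  · intro s hs
    rw [mem_closedBall, dist_eq_norm] at hs
    have hre := abs_re_le_norm (s - 2)
    have him := abs_im_le_norm (s - 2)
    rw [sub_re, show (2 : ℂ).re = 2 from rfl] at hre
    rw [sub_im, show (2 : ℂ).im = 0 from rfl, sub_zero] at him
    have hre' := abs_le.mp (hre.trans hs)
    have h1 : 1 / 2 ≤ s.re := by linarith [hre'.1]
    have h2 : s.re ≤ 7 / 2 := by linarith [hre'.2]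
    have h3 : |s.im| ≤ 3 / 2 := him.trans hs
    show ‖G₀ s * Bβ s * (Bv s)⁻¹‖ ≤ _
    rw [norm_mul, norm_mul]
    have hb1 : ‖Bβ s‖ ≤ (((∏ p ∈ S, p : ℕ) : ℝ)) ^ m := norm_prod_one_sub_le_pow hS hβ h1
    have hb2 : ‖(Bv s)⁻¹‖ ≤ (((∏ p ∈ S, p : ℕ) : ℝ)) ^ (2 * m') := norm_inv_prod_one_sub_le_pow hS hv h1
    have hR0 : (0 : ℝ) ≤ ((∏ p ∈ S, p : ℕ) : ℝ) := by positivity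
    calc ‖G₀ s‖ * ‖Bβ s‖ * ‖(Bv s)⁻¹‖
        ≤ Bnd * (((∏ p ∈ S, p : ℕ) : ℝ)) ^ m * (((∏ p ∈ S, p : ℕ) : ℝ)) ^ (2 * m') :=
          mul_le_mul (mul_le_mul (hG₀bound s h1 h2 h3) hb1 (norm_nonneg _) hBnd0) hb2
            (norm_nonneg _) (mul_nonneg hBnd0 (pow_nonneg hR0 _))
      _ = C * (5 / 2 : ℝ) ^ A * max 1 D.Q ^ A * (((∏ p ∈ S, p : ℕ) : ℝ)) ^ (m + 2 * m') := by
          rw [hBnd, pow_add]; ring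

end SelbergDatum

end Literature.NumberTheory.LFunctions

end
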